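import Summits.Ventures.PercRepro.Night2DQm1Mass
import Summits.Ventures.PercRepro.Night2LocalSpread

/-!
# PercRepro — the «bases-only» regime at a general `|E ∖ G| = d ≤ q` modulo its target sum (night-2, gen 19)

The chain `Night2DQm1Loss` / `Mass` / `Cell` for `d = q − 1`, redone at a general `d ≤ q` with the request bound
`R = Φ/(2 + d)` (every thin member misses `≥ 2` points), `capDG = 1 − kΦ/(1 + d)`, `ρ = q + 1 − kColoops`, and the
«bases-only» hypothesis `0 ≤ cPrimeDG = capDG − (ρ − 2)R` (a shadow set with `|S ∖ K| ≥ ρ + 1` has `≤ ρ − 2` thin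
preimages, so it is never saturated): then a thin member with `|B ∖ K| ≥ ρ` loses nothing
(`loss_eq_zero_of_card_ge_dgen`), a hyperplane-basis member loses `≤ lambdaDG = R − capDG/ρ` (`loss_le_lambdaDG`),
the loss mass of a target is `≤ ρ C(|S ∖ K|, ρ) λ/(2^{n−ρ} − 1)` (`pi2Mass_le_dgen`), the residual capacity of a target
is `≥ c′` (`cap2_ge_cPrimeDG`) and `= 1` at the top `q − d + 1` levels (`Night2LocalTopLevels`).  Hence
**`localShadowHall_dgen_of_sum`**: (LI_G) as soon as the target sum `dgenSum n q d ρ k ≥ 1` at `n = |G ∖ K|`, with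
`c_j = c′` for `j + ρ + (q − d + 1) ≤ n` and `1` at the top levels; **`dgenSum_eq`** is its closed form
`(c′ · Aρt(n) + T(n)) / (ρ λ C(n, ρ))`, `Aρt(n) = Σ_{i=ρ+1}^{n−(q−d)−1} C(n, i)`, `T(n) = Σ_{i=n−(q−d)}^{n} C(n, i)`.
At `q = 5` the hypothesis `0 ≤ c′` holds at the cells `(3, 0)` (`c′ = 1/15`) and `(3, 1)` (`c′ = 1/120`) besides the
`d = 4` cells (`proofs/NIGHT-2-g19.md` §6).
-/

namespace PercRepro.Shadow

open Finset PerFlat ThmH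

/-- `capDG q d k = 1 − kΦ/(1 + d)`. -/
noncomputable def capDG (q d k : ℕ) : ℚ := 1 - (k : ℚ) * phiQ q / (1 + (d : ℚ))

/-- The request bound `R = Φ/(2 + d)`. -/
noncomputable def reqDG (q d : ℕ) : ℚ := phiQ q / (2 + (d : ℚ))

/-- `lambdaDG = R − capDG/ρ`. -/
noncomputable def lambdaDG (q d ρ k : ℕ) : ℚ := reqDG q d - capDG q d k / (ρ : ℚ)

/-- `cPrimeDG = capDG − (ρ − 2) R`. -/
noncomputable def cPrimeDG (q d ρ k : ℕ) : ℚ := capDG q d k - ((ρ : ℚ) - 2) * reqDG q d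

namespace DGen

/-- The coefficient of the targets of size `ρ + j` off the coloops. -/
noncomputable def cjDG (n q d ρ k j : ℕ) : ℚ := if j + ρ + (q - d + 1) ≤ n then cPrimeDG q d ρ k else 1

/-- The target sum at a general `d`. -/
noncomputable def dgenSum (n q d ρ k : ℕ) : ℚ :=
  ∑ j ∈ Finset.Icc 1 (n - ρ),
    ((n - ρ).choose j : ℚ) * (cjDG n q d ρ k j / ((ρ : ℚ) * lambdaDG q d ρ k * ((j + ρ).choose ρ : ℚ)))

/-- `Aρt(n) = Σ_{i=ρ+1}^{n−t} C(n, i)` with `t = q − d + 1` top levels excluded. -/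
def Aρt (n ρ t : ℕ) : ℕ := ∑ i ∈ Finset.Ico (ρ + 1) (n + 1 - t), n.choose i

/-- `T(n) = Σ_{i=n+1−t}^{n} C(n, i)`, the top `t` levels. -/
def Ttop (n t : ℕ) : ℕ := ∑ i ∈ Finset.Ico (n + 1 - t) (n + 1), n.choose i

end DGen

variable {α : Type*} [DecidableEq α] {M : Matroid α} [M.Finite]

/-- `capDG > 0` when `k + 1 ≤ d`, `d ≤ q`. -/
theorem capDG_pos {q d k : ℕ} (hkd : k + 1 ≤ d) (hdq : d ≤ q) : 0 < capDG q d k := by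
  unfold capDG phiQ
  have hk : (k : ℚ) + 1 ≤ (d : ℚ) := by exact_mod_cast hkd
  have hd : (d : ℚ) ≤ (q : ℚ) := by exact_mod_cast hdq
  have hk0 : (0 : ℚ) ≤ (k : ℚ) := by positivity
  have e : (k : ℚ) * (((q : ℚ) + 2) / ((q : ℚ) + 1)) / (1 + (d : ℚ)) =
      (k : ℚ) * ((q : ℚ) + 2) / (((q : ℚ) + 1) * (1 + (d : ℚ))) := by field_simp
  rw [sub_pos, e, div_lt_one (by positivity)]
  nlinarith

/-- `reqDG > 0`. -/
theorem reqDG_pos (q d : ℕ) : 0 < reqDG q d := by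
  unfold reqDG; exact div_pos (phiQ_pos q) (by positivity)

/-- Every thin member requests at most `reqDG = Φ/(2 + d)`. -/
theorem req_le_reqDG {q d : ℕ} {G : Finset α} (hG : G ∈ flatsQ M (q + 1)) (hd : (gr M \ G).card = d)
    (hdq : d ≤ q) {B : Finset α} (hB : B ∈ thinMembers M q G) : req M q B ≤ reqDG q d := by
  have hm := two_le_card_sdiff_of_not_lay0 hG (by omega) (mem_thinMembers.1 hB).1 (mem_thinMembers.1 hB).2
  have := req_le_of_spread hG hd hB hm
  unfold reqDG
  push_cast at this ⊢
  exact this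

open scoped Classical in
/-- `L1 S ≤ (ρ − 2) R` at a shadow set with `|S ∖ K| ≥ ρ + 1`. -/
theorem L1_le_of_card_ge_dgen {q d ρ : ℕ} {G : Finset α} (hG : G ∈ flatsQ M (q + 1))
    (hd : (gr M \ G).card = d) (hdq : d ≤ q) (hk : kColoops M G + ρ = q + 1)
    (hs : ∀ e ∈ gr M, ∀ f ∈ gr M, e ≠ f → rkN M {e, f} = 2) (hl : ∀ e ∈ gr M, M.Indep {e}) {S : Finset α}
    (hS : S ∈ shadowAt M (q + 2) q (Uq M (q + 2) q) G) (hcard : ρ + 1 ≤ (S \ coloops M G).card) :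
    L1 M q G S ≤ ((ρ : ℚ) - 2) * reqDG q d := by
  have hd' : (gr M \ G).card ≤ q := by omega
  unfold L1
  have hterm : ∀ B ∈ (coverPreimages M (Uq M (q + 2) q) G S).filter (fun B => B ∉ lay0 M q G),
      req M q B ≤ reqDG q d := by
    intro B hB
    rw [Finset.mem_filter, mem_coverPreimages] at hB
    exact req_le_reqDG hG hd hdq (mem_thinMembers.2 ⟨hB.1.1, hB.2⟩)
  have hcount := card_thin_coverPreimages_add_two_le hG hd' hk hs hl hS hcard
  calc ∑ B ∈ (coverPreimages M (Uq M (q + 2) q) G S).filter (fun B => B ∉ lay0 M q G), req M q B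
      ≤ ∑ _B ∈ (coverPreimages M (Uq M (q + 2) q) G S).filter (fun B => B ∉ lay0 M q G), reqDG q d :=
        Finset.sum_le_sum hterm
    _ = (((coverPreimages M (Uq M (q + 2) q) G S).filter (fun B => B ∉ lay0 M q G)).card : ℚ) * reqDG q d := by
        rw [Finset.sum_const, nsmul_eq_mul]
    _ ≤ ((ρ : ℚ) - 2) * reqDG q d := by
        apply mul_le_mul_of_nonneg_right _ (reqDG_pos q d).le
        have : (((coverPreimages M (Uq M (q + 2) q) G S).filter (fun B => B ∉ lay0 M q G)).card : ℚ) + 2 ≤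
            (ρ : ℚ) := by exact_mod_cast hcount
        linarith

open scoped Classical in
/-- `L1 (B ∪ {z}) ≤ (|B ∖ K| + 1) R` for a thin member. -/
theorem L1_insert_le_dgen {q d : ℕ} {G : Finset α} (hG : G ∈ flatsQ M (q + 1)) (hd : (gr M \ G).card = d)
    (hdq : d ≤ q) {B : Finset α} (hB : B ∈ thinMembers M q G) {z : α} (hz : z ∈ G \ clF M B) :
    L1 M q G (insert z B) ≤ (((B \ coloops M G).card : ℚ) + 1) * reqDG q d := by
  have hd' : (gr M \ G).card ≤ q := by omega
  have hB' : B ∈ membersIn M (Uq M (q + 2) q) G := (mem_thinMembers.1 hB).1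
  have hBU : B ∈ Uq M (q + 2) q := (mem_membersIn.1 hB').1
  have hzB : z ∉ B := notMem_of_notMem_clF hBU (Finset.mem_sdiff.1 hz).2
  unfold L1
  have hterm : ∀ B' ∈ (coverPreimages M (Uq M (q + 2) q) G (insert z B)).filter (fun B' => B' ∉ lay0 M q G),
      req M q B' ≤ reqDG q d := by
    intro B' hB'
    rw [Finset.mem_filter, mem_coverPreimages] at hB'
    exact req_le_reqDG hG hd hdq (mem_thinMembers.2 ⟨hB'.1.1, hB'.2⟩)
  calc ∑ B' ∈ (coverPreimages M (Uq M (q + 2) q) G (insert z B)).filter (fun B' => B' ∉ lay0 M q G), req M q B'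
      ≤ ∑ _B' ∈ (coverPreimages M (Uq M (q + 2) q) G (insert z B)).filter (fun B' => B' ∉ lay0 M q G),
          reqDG q d := Finset.sum_le_sum hterm
    _ = (((coverPreimages M (Uq M (q + 2) q) G (insert z B)).filter (fun B' => B' ∉ lay0 M q G)).card : ℚ) *
          reqDG q d := by rw [Finset.sum_const, nsmul_eq_mul]
    _ ≤ (((B \ coloops M G).card : ℚ) + 1) * reqDG q d := by
        apply mul_le_mul_of_nonneg_right _ (reqDG_pos q d).le
        have h1 := Finset.card_le_card (coverPreimages_thin_subset_image hG hd' B z)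
        have h2 := Finset.card_image_le (s := insert z (B \ coloops M G)) (f := fun w => (insert z B).erase w)
        have hzK : z ∉ B \ coloops M G := fun h => hzB (Finset.mem_sdiff.1 h).1
        rw [Finset.card_insert_of_notMem hzK] at h2
        exact_mod_cast h1.trans h2

open scoped Classical in
/-- **Bases-only regime: a thin member with `|B ∖ K| ≥ ρ` loses nothing** (`0 ≤ cPrimeDG`). -/
theorem loss_eq_zero_of_card_ge_dgen {q d ρ : ℕ} {G : Finset α} (hG : G ∈ flatsQ M (q + 1))
    (hd : (gr M \ G).card = d) (hdq : d ≤ q) (hk : kColoops M G + ρ = q + 1)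
    (hc : 0 ≤ cPrimeDG q d ρ (kColoops M G))
    (hs : ∀ e ∈ gr M, ∀ f ∈ gr M, e ≠ f → rkN M {e, f} = 2) (hl : ∀ e ∈ gr M, M.Indep {e})
    {B : Finset α} (hB : B ∈ thinMembers M q G) (hcard : ρ ≤ (B \ coloops M G).card) {z : α}
    (hz : z ∈ G \ clF M B) : loss M q G B z = 0 := by
  have hd' : (gr M \ G).card ≤ q := by omega
  have hSsh := insert_mem_shadowAt_thin hG hB hz
  have hSG : insert z B ⊆ G := subset_G_of_mem_shadowAt hSsh
  have hL : L1 M q G (insert z B) ≤ capS M q G (insert z B) := by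
    have h1 := L1_le_of_card_ge_dgen hG hd hdq hk hs hl hSsh
      (by rw [card_insert_sdiff_coloops_thin hG hd' hB hz]; omega)
    have h2 := capS_ge_one_sub_kColoops (q := q) hd hSG
    unfold cPrimeDG capDG at hc
    linarith
  unfold loss fS
  rw [if_pos hL]
  ring

open scoped Classical in
/-- **A hyperplane-basis member loses at most `lambdaDG` at any covering set** (`k + 1 ≤ d ≤ q`, `ρ ≥ 1`). -/
theorem loss_le_lambdaDG {q d ρ : ℕ} {G : Finset α} (hG : G ∈ flatsQ M (q + 1))
    (hd : (gr M \ G).card = d) (hdq : d ≤ q) (hkd : kColoops M G + 1 ≤ d) (hρ : 1 ≤ ρ) {B : Finset α}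
    (hB : B ∈ thinMembers M q G) (hcard : (B \ coloops M G).card + 1 = ρ) {z : α} (hz : z ∈ G \ clF M B)
    (hlam : 0 ≤ lambdaDG q d ρ (kColoops M G)) : loss M q G B z ≤ lambdaDG q d ρ (kColoops M G) := by
  have hSsh := insert_mem_shadowAt_thin hG hB hz
  have hSG : insert z B ⊆ G := subset_G_of_mem_shadowAt hSsh
  set R : ℚ := reqDG q d with hR
  set c : ℚ := capDG q d (kColoops M G) with hc
  have hRpos : 0 < R := reqDG_pos q d
  have hcpos : 0 < c := capDG_pos hkd hdq
  have hρpos : (0 : ℚ) < (ρ : ℚ) := by exact_mod_cast hρ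
  have hreq : req M q B ≤ R := req_le_reqDG hG hd hdq hB
  have hreq0 : 0 ≤ req M q B := req_nonneg q B
  have hL1 : L1 M q G (insert z B) ≤ (ρ : ℚ) * R := by
    have := L1_insert_le_dgen hG hd hdq hB hz
    have hρ' : ((B \ coloops M G).card : ℚ) + 1 = (ρ : ℚ) := by exact_mod_cast hcard
    rw [hρ'] at this
    exact this
  have hcap : c ≤ capS M q G (insert z B) := capS_ge_one_sub_kColoops (q := q) hd hSG
  unfold loss fS
  split_ifs with hle
  · simp only [sub_self, mul_zero]
    exact hlam
  · push Not at hle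
    have hLpos : 0 < L1 M q G (insert z B) := hcpos.trans (hcap.trans_lt hle)
    have hfrac : c / ((ρ : ℚ) * R) ≤ capS M q G (insert z B) / L1 M q G (insert z B) := by
      rw [div_le_div_iff₀ (by positivity) hLpos]
      calc c * L1 M q G (insert z B) ≤ c * ((ρ : ℚ) * R) := mul_le_mul_of_nonneg_left hL1 hcpos.le
        _ ≤ capS M q G (insert z B) * ((ρ : ℚ) * R) := mul_le_mul_of_nonneg_right hcap (by positivity)
    have h1 : 1 - capS M q G (insert z B) / L1 M q G (insert z B) ≤ 1 - c / ((ρ : ℚ) * R) := by linarith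
    have h1' : 0 ≤ 1 - capS M q G (insert z B) / L1 M q G (insert z B) := by
      rw [sub_nonneg, div_le_one hLpos]; exact hle.le
    calc req M q B * (1 - capS M q G (insert z B) / L1 M q G (insert z B))
        ≤ R * (1 - c / ((ρ : ℚ) * R)) := mul_le_mul hreq h1 h1' hRpos.le
      _ = lambdaDG q d ρ (kColoops M G) := by
          unfold lambdaDG
          rw [← hR, ← hc]
          field_simp

open scoped Classical in
/-- A loss pair with positive weight is a hyperplane-basis member (bases-only regime). -/
theorem card_sdiff_add_one_eq_of_rhoL_ne_zero_dgen {q d ρ : ℕ} {G : Finset α} (hG : G ∈ flatsQ M (q + 1))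
    (hd : (gr M \ G).card = d) (hdq : d ≤ q) (hk : kColoops M G + ρ = q + 1)
    (hc : 0 ≤ cPrimeDG q d ρ (kColoops M G))
    (hs : ∀ e ∈ gr M, ∀ f ∈ gr M, e ≠ f → rkN M {e, f} = 2) (hl : ∀ e ∈ gr M, M.Indep {e})
    {B : Finset α} (hB : B ∈ thinMembers M q G) {z : α} (hz : z ∈ G \ clF M B)
    (hρ' : rhoL M q G B z ≠ 0) : (B \ coloops M G).card + 1 = ρ := by
  have hd' : (gr M \ G).card ≤ q := by omega
  have hloss : loss M q G B z ≠ 0 := by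
    intro h; apply hρ'; unfold rhoL; rw [h, zero_div]
  have hge := card_sdiff_coloops_thin_ge hG hd' hk hB
  by_contra hne
  exact hloss (loss_eq_zero_of_card_ge_dgen hG hd hdq hk hc hs hl hB (by omega) hz)

open scoped Classical in
/-- **The loss mass of a shadow set is at most `ρ C(|S ∖ K|, ρ) λ/(2^{n−ρ} − 1)`** (bases-only regime). -/
theorem pi2Mass_le_dgen {q d ρ : ℕ} {G : Finset α} (hG : G ∈ flatsQ M (q + 1)) (hd : (gr M \ G).card = d)
    (hdq : d ≤ q) (hk : kColoops M G + ρ = q + 1) (hkd : kColoops M G + 1 ≤ d) (hρ : 1 ≤ ρ)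
    (hc : 0 ≤ cPrimeDG q d ρ (kColoops M G)) (hlam : 0 ≤ lambdaDG q d ρ (kColoops M G))
    (hs : ∀ e ∈ gr M, ∀ f ∈ gr M, e ≠ f → rkN M {e, f} = 2) (hl : ∀ e ∈ gr M, M.Indep {e})
    (S : Finset α) :
    pi2Mass M q G S ≤
      ((ρ : ℚ) * ((S \ coloops M G).card.choose ρ : ℚ)) *
        (lambdaDG q d ρ (kColoops M G) / ((2 ^ ((G.card - kColoops M G) - ρ) - 1 : ℕ) : ℚ)) := by
  have hd' : (gr M \ G).card ≤ q := by omega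
  rw [pi2Mass_eq_sum_lossPairsAt]
  set r := (G.card - kColoops M G) - ρ with hr
  set w : ℚ := lambdaDG q d ρ (kColoops M G) / ((2 ^ r - 1 : ℕ) : ℚ) with hw
  have hw0 : 0 ≤ w := by rw [hw]; exact div_nonneg hlam (by positivity)
  have hterm : ∀ p ∈ lossPairsAt M q G S, rhoL M q G p.1 p.2 ≤
      if rhoL M q G p.1 p.2 = 0 then 0 else w := by
    intro p hp
    split_ifs with h0
    · rw [h0]
    · unfold lossPairsAt at hp
      rw [Finset.mem_filter, Finset.mem_image] at hp
      obtain ⟨⟨x, hx, rfl⟩, hpS⟩ := hp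
      rw [Finset.mem_sigma] at hx
      obtain ⟨hB, hz⟩ := hx
      have h2 := card_sdiff_add_one_eq_of_rhoL_ne_zero_dgen hG hd hdq hk hc hs hl hB hz h0
      unfold rhoL
      rw [card_tgtSets hG (mem_thinMembers.1 hB).1 hz, card_sdiff_insert_eq_dqm1 hG hd' hB h2 hz, ← hr, hw]
      apply div_le_div_of_nonneg_right _ (by positivity)
      exact loss_le_lambdaDG hG hd hdq hkd hρ hB h2 hz hlam
  calc ∑ p ∈ lossPairsAt M q G S, rhoL M q G p.1 p.2
      ≤ ∑ p ∈ lossPairsAt M q G S, (if rhoL M q G p.1 p.2 = 0 then 0 else w) := Finset.sum_le_sum hterm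
    _ = ((lossPairsAt M q G S).filter (fun p => rhoL M q G p.1 p.2 ≠ 0)).card * w := by
        rw [Finset.sum_ite, Finset.sum_const_zero, zero_add, Finset.sum_const, nsmul_eq_mul]
    _ ≤ ((ρ : ℚ) * ((S \ coloops M G).card.choose ρ : ℚ)) * w := by
        apply mul_le_mul_of_nonneg_right _ hw0
        have hinj : ((lossPairsAt M q G S).filter (fun p => rhoL M q G p.1 p.2 ≠ 0)).card ≤
            (((S \ coloops M G).powersetCard ρ).sigma (fun T => T)).card := by
          apply Finset.card_le_card_of_injOn (fun p => ⟨insert p.2 (p.1 \ coloops M G), p.2⟩)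
          · intro p hp
            rw [Finset.mem_coe, Finset.mem_filter] at hp
            obtain ⟨hp, hρ'⟩ := hp
            unfold lossPairsAt at hp
            rw [Finset.mem_filter, Finset.mem_image] at hp
            obtain ⟨⟨x, hx, rfl⟩, hpS⟩ := hp
            rw [Finset.mem_sigma] at hx
            obtain ⟨hB, hz⟩ := hx
            have h2 := card_sdiff_add_one_eq_of_rhoL_ne_zero_dgen hG hd hdq hk hc hs hl hB hz hρ'
            have hB' : x.1 ∈ membersIn M (Uq M (q + 2) q) G := (mem_thinMembers.1 hB).1
            have hBU : x.1 ∈ Uq M (q + 2) q := (mem_membersIn.1 hB').1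
            have hzB : x.2 ∉ x.1 := notMem_of_notMem_clF hBU (Finset.mem_sdiff.1 hz).2
            have hzK : x.2 ∉ x.1 \ coloops M G := fun hh => hzB (Finset.mem_sdiff.1 hh).1
            have hsub : insert x.2 x.1 ⊆ S := (mem_tgtSets.1 hpS).2.1
            rw [Finset.mem_coe, Finset.mem_sigma, Finset.mem_powersetCard]
            refine ⟨⟨?_, ?_⟩, Finset.mem_insert_self _ _⟩
            · intro y hy
              rw [Finset.mem_insert] at hy
              rw [Finset.mem_sdiff]
              rcases hy with rfl | hy
              · refine ⟨hsub (Finset.mem_insert_self _ _), ?_⟩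
                intro hzc
                exact hzB (coloops_subset_of_mem_thinMembers hG hd' hB hzc)
              · rw [Finset.mem_sdiff] at hy
                exact ⟨hsub (Finset.mem_insert_of_mem hy.1), hy.2⟩
            · rw [Finset.card_insert_of_notMem hzK, h2]
          · intro p hp p' hp' heq
            rw [Finset.mem_coe, Finset.mem_filter] at hp hp'
            obtain ⟨hp, -⟩ := hp
            obtain ⟨hp', -⟩ := hp'
            unfold lossPairsAt at hp hp'
            rw [Finset.mem_filter, Finset.mem_image] at hp hp'
            obtain ⟨⟨x, hx, rfl⟩, -⟩ := hp
            obtain ⟨⟨x', hx', rfl⟩, -⟩ := hp'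
            rw [Finset.mem_sigma] at hx hx'
            simp only [Sigma.mk.injEq] at heq
            obtain ⟨hT, hzz⟩ := heq
            have hzz' : x.2 = x'.2 := eq_of_heq hzz
            have hBU : x.1 ∈ Uq M (q + 2) q := (mem_membersIn.1 (mem_thinMembers.1 hx.1).1).1
            have hBU' : x'.1 ∈ Uq M (q + 2) q := (mem_membersIn.1 (mem_thinMembers.1 hx'.1).1).1
            have hB := lossPairs_inj hG hd' hx.1 hx'.1 hT hzz'
              (notMem_of_notMem_clF hBU (Finset.mem_sdiff.1 hx.2).2)
              (notMem_of_notMem_clF hBU' (Finset.mem_sdiff.1 hx'.2).2)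
            exact Prod.ext hB hzz'
        have hcount : (((S \ coloops M G).powersetCard ρ).sigma (fun T => T)).card =
            ρ * (S \ coloops M G).card.choose ρ := by
          rw [Finset.card_sigma]
          have : ∀ T ∈ (S \ coloops M G).powersetCard ρ, T.card = ρ :=
            fun T hT => (Finset.mem_powersetCard.1 hT).2
          rw [Finset.sum_congr rfl this, Finset.sum_const, Finset.card_powersetCard, smul_eq_mul, mul_comm]
        have := hinj.trans hcount.le
        exact_mod_cast this

open scoped Classical in
/-- **`cap2 S ≥ c′` at every shadow set with `|S ∖ K| ≥ ρ + 1`** (bases-only regime). -/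
theorem cap2_ge_cPrimeDG {q d ρ : ℕ} {G : Finset α} (hG : G ∈ flatsQ M (q + 1))
    (hd : (gr M \ G).card = d) (hdq : d ≤ q) (hk : kColoops M G + ρ = q + 1)
    (hs : ∀ e ∈ gr M, ∀ f ∈ gr M, e ≠ f → rkN M {e, f} = 2) (hl : ∀ e ∈ gr M, M.Indep {e}) {S : Finset α}
    (hS : S ∈ shadowAt M (q + 2) q (Uq M (q + 2) q) G) (hcard : ρ + 1 ≤ (S \ coloops M G).card) :
    cPrimeDG q d ρ (kColoops M G) ≤ cap2 M q G S := by
  have hd' : (gr M \ G).card ≤ q := by omega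
  unfold cPrimeDG
  have h1 := cap2_ge_capS_sub_L1_of_le hG hd' S
  have h2 := capS_ge_one_sub_kColoops (q := q) hd (subset_G_of_mem_shadowAt hS)
  have h3 := L1_le_of_card_ge_dgen hG hd hdq hk hs hl hS hcard
  unfold capDG
  linarith

end PercRepro.Shadow
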